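import Summits.HodgeConjecture.HodgeConjecture.Theorems.VHCAbelianSchemesRoadSplitWeilTensorAnchors
import Summits.HodgeConjecture.HodgeConjecture.Theorems.Ring2AbelianAllSplitWeilClassesDefs
import Summits.HodgeConjecture.HodgeConjecture.Theorems.Ring2DeformCompactPencils
import Summits.HodgeConjecture.HodgeConjecture.Theses.VHCAbelianSchemesRoad
import Summits.HodgeConjecture.HodgeConjecture.Theorems.Ring2HypothesesWeilComponentsCM
import Literature.AlgebraicGeometry.Deligne1982.WeilTypeCMQuadratic
import HarnessLib

/-!
# Ring 2 / AbelianAll (André column) — SPLIT `E`-WEIL CLASSES, EVERY CM FIELD, FROM TWISTED CARRIERS FOR `E`-WEIL CLASSES AT TENSOR POINTS OVER ONE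
# ELLIPTIC CURVE; `HC_CM` AND the split Weil classes from ONE node — the rows of PART AD on the cell's named decls (leaf file)

research route, not a corollary; conditional on HC_CM plus one named minimal statement.

LEAF FILE (imports route files; nothing should import it). PART AC-f (gen 60) landed `HC_CM ⟸ K-C ∧ TwistedPerfectDoor ∧ andre1996_cmHodgeClasses_weilTensorPencils
∧ EllipticTensorWeilTwistedCarriers E₀` (ONE elliptic curve `E₀`). The node `EllipticTensorWeilTwistedCarriers E₀` — twisted carriers, modulo the `θ`-ray, for the
RATIONAL `E`-WEIL classes of CM-field structures on polarised abelian varieties isogenous to powers of `E₀` — is blind to where the pencil comes from; André's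
Lemme 6.3.3 ALONE (split `E`-Weil data, no CM hypothesis; tensor form `andre1996_splitWeilClasses_weilTensorPencil`, statement only, this generation) sends
EVERY split `E`-Weil structure, every CM field `E`, to the same tensor points. On the named decls (class target `AndreSplitWeilClasses`, PART AD-b0):

* §0 ON-PATH and comparison: `AndreSplitWeilClasses` is a case of the summit and of `HC_AV`; it follows from the literature seat's fact and the road's
  `CompactAbelianPencilVHC` (André's Remarque 2 — the existing edge, now on the named node);
* §1 **`andreSplitWeilClasses_of_ellipticTensorWeilTwistedCarriers : K-C → TwistedPerfectDoor → andre1996_splitWeilClasses_weilTensorPencil → E₀.dim = 1 →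
  EllipticTensorWeilTwistedCarriers E₀ → AndreSplitWeilClasses`** (door-generic form first); packaged forms (the whole line `W_E ⊗ ℂ`; pull-backs);
* §2 **`HC_CM_and_andreSplitWeilClasses_of_ellipticTensorWeilTwistedCarriers`** — ONE node, TWO axes: K-C ∧ door ∧ the two Weil-tensor facts ∧
  `EllipticTensorWeilTwistedCarriers E₀` ⟹ `HC_CM ∧ AndreSplitWeilClasses`;
* §3 lattice: from `EllipticPowerAlgebraicTwistedCarriers` (PART AB) and from `AbelianTwistedDesigns` (PART Z/AB), through the road-side comparison lemmas.
* §4 (appended) PLACEMENT IN THE LADDER: `AndreSplitWeilClasses` is a CASE of the ladder's `WeilClassesWeilTypeCM` (R3 on Deligne's carriers, `e₀ ≥ 2`)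
  ∧ `WeilClassesImaginaryQuadratic` (R∞, `e₀ = 1`: a degree-one monic `R` with negative root is `T + d`, and `W_E ⊗ ℂ = weilClassesOf`) — so the new target
  is no stronger than the ladder's existing open targets (it forgets the split polarisation).

HONEST: every carrier node is OPEN, not in print and NOT implied by the Hodge conjecture; the two André facts are THEOREMS IN PRINT entering BY NAME; the door
is the road's binder (labels: route file; `bfSingleAdmissible` disjunct print-supported for `B₀ = 0` or initial-segment degree sets, RING2-MAP §AbelianAll AA2.487);
`AndreSplitWeilClasses` is OPEN in print for `2p·e₀ ≥ 8` (Markman §1.2, §12). `HC_CM` occurs only as a CONCLUSION (§2). Nothing here says any carrier, door,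
Weil class, `HC_CM`, `HC_AV` or HC holds. References: [cite: Andre1996Motifs, §6.3 b)–c), Lemmes 6.3.2–6.3.3 and proof of 6.3.3 (pp. 32–33), Remarque 2]
[cite: Deligne1982HodgeCycles, §4 Cor. 4.2, Thm. 4.8 (b), Remark 4.10] [cite: MoonenZarhin1998WeilClasses, §1] [cite: Bloch1972Semiregularity, Remark (7.5)]
[cite: BuchweitzFlenner2003, §5 Thm. 5.1] [cite: Pridham2024Semiregularity, Cor. 2.25 and Rem. 2.26–2.27] [cite: Markman2025SecantWeil, §1.2] [cite: Milne1999, §7 p. 72].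
-/

noncomputable section

open CategoryTheory CategoryTheory.Limits AlgebraicGeometry Topology

namespace Summit.HodgeConjecture.HodgeConjecture.Ring2.AbelianAll

-- the cell's namespace repeats the summit name (`Summit.HodgeConjecture.HodgeConjecture…`), as in every `Ring2*` file
set_option linter.dupNamespace false

open Literature.AlgebraicGeometry Literature.AlgebraicGeometry.Motives
open Literature.AlgebraicGeometry.HodgeTheory
open Literature.AlgebraicGeometry.Deligne1982
open Literature.AlgebraicGeometry.VanGeemen1994 (pullbackOne)
open Literature.AlgebraicTopology.SingularHomology
open Literature.AlgebraicGeometry.Abdulali1994 (InvariantCyclesHoldFor)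
open Literature.AlgebraicGeometry.Milne1999 (IsOfCMType CMHodgeHypothesisAt)
open Literature.AlgebraicGeometry.Andre1996 (andre1996_cmHodgeClasses_weilTensorPencils andre1996_splitWeilClasses_weilTensorPencil
  andre1996_splitWeilClasses_algebraicallyAnchoredPencil)
open Summit.Ventures.HSemireg (ObjClass LocalVariationalHodgeFor)
open Summit.HodgeConjecture.HodgeConjecture.Theses
open Summit.HodgeConjecture.HodgeConjecture.Ring2.Deform (CompactAbelianPencilVHC)
open Summit.HodgeConjecture.HodgeConjecture.Ring2.SemiregularRepresentatives (AnchoredCarrierAt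
  twistedPerfectDoorVHC_iff_localVariationalHodgeFor cmHodgeHypothesisAt_of_weilTensorPencils_of_door_of_anchoredCarrierAt
  splitWeilClass_mem_algebraicClasses_of_weilTensorPencil_of_door_of_anchoredCarrierAt weilTensorCarrierAt_of_ellipticPowerAlgebraicCarrierAt
  ellipticPowerAlgebraicCarrierAt_of_pinnedDesignAt andre1996_splitWeilClasses_algebraicallyAnchoredPencil_of_weilTensorPencil)

/-! ## §0 ON-PATH lemmas and the existing (variational) edge, on the named node -/

/-- ON-PATH: `AndreSplitWeilClasses` is a case of the summit (Weil classes of a Weil-type CM datum are rational `(p,p)` classes — Moonen–Zarhin, a theorem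
of the tree — on a smooth projective variety). [cite: MoonenZarhin1998WeilClasses, §1 (Criterion)] [cite: Deligne2000, §1] -/
theorem andreSplitWeilClasses_of_hodgeConjecture (h : _root_.HodgeConjecture) : AndreSplitWeilClasses :=
  fun _ _ _ _ p _ _ hB _ _ _ _ w hw hwQ ↦
    (h hB.isSmoothProjective).2 p w hwQ (hB.isOfHodgeType_of_mem_weilClassesField MoonenZarhin1998_weilClasses_hodgeCriterion_holds hw)

/-- ON-PATH: `HC_AV → AndreSplitWeilClasses`. [cite: MoonenZarhin1998WeilClasses, §1 (Criterion)] [cite: Deligne2000, §1] -/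
theorem andreSplitWeilClasses_of_hodgeAbelianVarieties (h : PadicSemiregularLift.HodgeAbelianVarieties) : AndreSplitWeilClasses :=
  fun B _ _ _ p _ _ hB _ _ _ _ w hw hwQ ↦
    (h B).2 p w hwQ (hB.isOfHodgeType_of_mem_weilClassesField MoonenZarhin1998_weilClasses_hodgeCriterion_holds hw)

/-- **The existing edge, on the named node**: the literature seat's `andre1996_splitWeilClasses_algebraicallyAnchoredPencil` ∧ the road's `CompactAbelianPencilVHC`
(André's Remarque-2 input: `InvariantCyclesHoldFor` on every compact abelian pencil) ⟹ `AndreSplitWeilClasses` (its `…mem_algebraicClasses`, every `p ≥ 1`).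
[cite: Andre1996Motifs, §6.3 c) and Remarque 2 (p. 33)] [cite: Abdulali1994FamiliesAV, (1.1)] -/
theorem andreSplitWeilClasses_of_splitFact_of_compactAbelianPencilVHC (h63 : andre1996_splitWeilClasses_algebraicallyAnchoredPencil)
    (hV : CompactAbelianPencilVHC) : AndreSplitWeilClasses :=
  fun _ _ _ _ _ _ _ hB ha ha₀ hRos hsplit _ hw hwQ ↦
    h63.mem_algebraicClasses (fun _ _ f hf ↦ hV f hf) hB hB.k_pos ha ha₀ hRos hsplit hw hwQ

/-- … hence from the TENSOR form of the fact (which implies the literature seat's) ∧ `CompactAbelianPencilVHC`. [cite: Andre1996Motifs, §6.3 c) and Remarque 2 (p. 33)] -/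
theorem andreSplitWeilClasses_of_weilTensorPencil_of_compactAbelianPencilVHC (h : andre1996_splitWeilClasses_weilTensorPencil)
    (hV : CompactAbelianPencilVHC) : AndreSplitWeilClasses :=
  andreSplitWeilClasses_of_splitFact_of_compactAbelianPencilVHC (andre1996_splitWeilClasses_algebraicallyAnchoredPencil_of_weilTensorPencil h) hV

/-! ## §1 `AndreSplitWeilClasses` from the door and twisted carriers for `E`-Weil classes at tensor points over ONE elliptic curve -/

/-- **Split `E`-Weil classes, every CM field, from the tensor fact, the door's local variational Hodge statement and CARRIERS FOR `E`-WEIL CLASSES AT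
TENSOR POINTS OVER ONE ELLIPTIC CURVE `E₀`** (door-generic; no CM hypothesis; `HC_CM` absent; cell-free; residual-free).
[cite: Andre1996Motifs, Lemme 6.3.3 and proof (p. 33)] [cite: MoonenZarhin1998WeilClasses, §1] [cite: BuchweitzFlenner2003, §5 Thm. 5.1] -/
theorem andreSplitWeilClasses_of_weilTensorPencil_of_door_of_ellipticTensorWeilCarriers (h : andre1996_splitWeilClasses_weilTensorPencil)
    {𝒪 : ObjClass} (hT : LocalVariationalHodgeFor 𝒪) {E₀ : AbelianVariety ℂ} (hE₀ : E₀.dim = 1) (hB : EllipticTensorWeilCarriers 𝒪 E₀) :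
    AndreSplitWeilClasses :=
  fun _ _ _ _ _ _ _ hW ha ha₀ hRos hsplit _ hw hwQ ↦
    splitWeilClass_mem_algebraicClasses_of_weilTensorPencil_of_door_of_anchoredCarrierAt h hT hE₀ (fun d p h2 h4 ↦ hB d p h2 h4) hW hW.k_pos
      ha ha₀ hRos hsplit hw hwQ

/-- **`AndreSplitWeilClasses ⟸ K-C ∧ TwistedPerfectDoor ∧ andre1996_splitWeilClasses_weilTensorPencil ∧ (ONE elliptic curve E₀) ∧ EllipticTensorWeilTwistedCarriers E₀`**
— the road's binders BY NAME, Lemme 6.3.3 (tensor form) BY NAME, and the node of PART AC-f: the Weil classes of EVERY split `E`-Weil structure, EVERY CM field `E`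
(Markman's open sectors «dimension `≥ 8`, any `K`» and «`[K:ℚ] > 2`» in André's format), from semiregular TWISTED representatives, modulo the `θ`-ray, of
`E`-WEIL classes of CM-field structures on abelian varieties isogenous to powers of ONE elliptic curve of our choice — the SAME node that gives `HC_CM` (AC-f).
[cite: Andre1996Motifs, Lemme 6.3.3 and proof (p. 33)] [cite: Pridham2024Semiregularity, Cor. 2.25 and Rem. 2.26–2.27] [cite: Markman2025SecantWeil, §1.2]
[cite: Bloch1972Semiregularity, Remark (7.5)] -/
theorem andreSplitWeilClasses_of_ellipticTensorWeilTwistedCarriers (hC : VHCAbelianSchemesRoad.ChernCharacterOnBetti)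
    (hDoor : VHCAbelianSchemesRoad.TwistedPerfectDoor) (h : andre1996_splitWeilClasses_weilTensorPencil) {E₀ : AbelianVariety ℂ}
    (hE₀ : E₀.dim = 1) (hB : EllipticTensorWeilTwistedCarriers E₀) : AndreSplitWeilClasses := by
  obtain ⟨C⟩ := (hC : Nonempty ChernCharacterBetti)
  exact andreSplitWeilClasses_of_weilTensorPencil_of_door_of_ellipticTensorWeilCarriers h
    ((twistedPerfectDoorVHC_iff_localVariationalHodgeFor C _).1 (hDoor C)) hE₀ (hB C)

section Packaged

variable {B : AbelianVariety ℂ} {η : B ⟶ B} {R : Polynomial ℤ} {e₀ p : ℕ}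
  {e : ProjectiveEmbedding B.X} {a : complexBetti (projectiveSpace e.n ℂ) 2}

/-- **Packaged: the whole line `W_E ⊗ ℂ` of a split datum is algebraic under `AndreSplitWeilClasses`** (`W_E ⊗ ℂ` is spanned by its rational classes).
[cite: MoonenZarhin1998WeilClasses, §1 Lemma (1)] -/
theorem AndreSplitWeilClasses.weilClassesField_le (h : AndreSplitWeilClasses) (hB : IsWeilTypeCM B η R e₀ p) (ha : IsRationalClass a) (ha₀ : a ≠ 0)
    (hRos : ∀ x y : complexBetti B.X 1,
      polarizationPairingOne B.X (complexBetti.map e.ι 2 a) (B.dim - 1) (pullbackOne B η x) y =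
        -polarizationPairingOne B.X (complexBetti.map e.ι 2 a) (B.dim - 1) x (pullbackOne B η y))
    (hsplit : IsHyperbolicWeilType B η (p * e₀) (complexBetti.map e.ι 2 a)) :
    weilClassesField B η (R.comp (Polynomial.X ^ 2)) (2 * p) ≤ algebraicClasses B.X p :=
  hB.weilClassesField_le_algebraicClasses_of_forall_isRationalClass (h B η R e₀ p e a hB ha ha₀ hRos hsplit)

/-- **Packaged: pull-backs** — under `AndreSplitWeilClasses`, `g^* w` is algebraic on every smooth projective `X ⟶ B.X` for every rational Weil class `w` of a
split datum (Fulton 19.2 (b) on abelian targets; the shape of the cell's K3-partner rows). [cite: Fulton1998, §19.2 Cor. 19.2 (b)] -/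
theorem AndreSplitWeilClasses.map_mem_algebraicClasses (h : AndreSplitWeilClasses) (hB : IsWeilTypeCM B η R e₀ p) (ha : IsRationalClass a)
    (ha₀ : a ≠ 0)
    (hRos : ∀ x y : complexBetti B.X 1,
      polarizationPairingOne B.X (complexBetti.map e.ι 2 a) (B.dim - 1) (pullbackOne B η x) y =
        -polarizationPairingOne B.X (complexBetti.map e.ι 2 a) (B.dim - 1) x (pullbackOne B η y))
    (hsplit : IsHyperbolicWeilType B η (p * e₀) (complexBetti.map e.ι 2 a)) {w : complexBetti B.X (2 * p)}
    (hw : w ∈ weilClassesField B η (R.comp (Polynomial.X ^ 2)) (2 * p)) (hwQ : IsRationalClass w)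
    {m : ℕ} {X : SchemeOver ℂ} (hX : IsSmoothProjective m X) (g : X ⟶ B.X) :
    complexBetti.map g (2 * p) w ∈ algebraicClasses X p :=
  map_mem_algebraicClasses_of_abelianVariety hX B g (h B η R e₀ p e a hB ha ha₀ hRos hsplit w hw hwQ)

end Packaged

/-! ## §2 ONE node, TWO axes: `HC_CM` and the split Weil classes of every CM field -/

/-- **`HC_CM ∧ AndreSplitWeilClasses ⟸ K-C ∧ TwistedPerfectDoor ∧ andre1996_cmHodgeClasses_weilTensorPencils ∧ andre1996_splitWeilClasses_weilTensorPencil ∧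
(ONE elliptic curve E₀) ∧ EllipticTensorWeilTwistedCarriers E₀`**: the Hodge conjecture for CM abelian varieties AND the Weil classes of every split `E`-Weil
structure, every CM field, from ONE carrier node on powers of ONE elliptic curve (the `HC_CM` half re-derived from the road-side engine of AC-f, not imported
from its leaf). [cite: Andre1996Motifs, §6.3 Lemmes 6.3.2–6.3.3 (pp. 32–33)] [cite: Pridham2024Semiregularity, Cor. 2.25 and Rem. 2.26–2.27]
[cite: Bloch1972Semiregularity, Remark (7.5)] [cite: Milne1999, §7 p. 72] -/
theorem HC_CM_and_andreSplitWeilClasses_of_ellipticTensorWeilTwistedCarriers (hC : VHCAbelianSchemesRoad.ChernCharacterOnBetti)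
    (hDoor : VHCAbelianSchemesRoad.TwistedPerfectDoor) (h₂₂ : andre1996_cmHodgeClasses_weilTensorPencils)
    (h₃₃ : andre1996_splitWeilClasses_weilTensorPencil) {E₀ : AbelianVariety ℂ} (hE₀ : E₀.dim = 1) (hB : EllipticTensorWeilTwistedCarriers E₀) :
    RankFourFaces.CMAbelianHodge ∧ AndreSplitWeilClasses := by
  obtain ⟨C⟩ := (hC : Nonempty ChernCharacterBetti)
  have hT := (twistedPerfectDoorVHC_iff_localVariationalHodgeFor C _).1 (hDoor C)
  exact ⟨fun B hB' hcm ↦ cmHodgeHypothesisAt_of_weilTensorPencils_of_door_of_anchoredCarrierAt h₂₂ hT hE₀ (fun d p h2 h4 ↦ hB C d p h2 h4) B hB' hcm,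
    andreSplitWeilClasses_of_weilTensorPencil_of_door_of_ellipticTensorWeilCarriers h₃₃ hT hE₀ (hB C)⟩

/-! ## §3 Lattice: from the elliptic-power-algebraic node and from pinned designs -/

/-- `AndreSplitWeilClasses ⟸ K-C ∧ TwistedPerfectDoor ∧ tensor fact ∧ EllipticPowerAlgebraicTwistedCarriers` (PART AB's node — carriers for ALL algebraic classes on
powers of EVERY elliptic curve — dominates the Weil-tensor node at any `E₀`; one exists in the tree). [cite: vanGeemen1994HodgeAV, Lemma 3.7 and Thm. 4.3]
[cite: Bloch1972Semiregularity, Remark (7.5)] -/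
theorem andreSplitWeilClasses_of_ellipticPowerAlgebraicTwistedCarriers (hC : VHCAbelianSchemesRoad.ChernCharacterOnBetti)
    (hDoor : VHCAbelianSchemesRoad.TwistedPerfectDoor) (h : andre1996_splitWeilClasses_weilTensorPencil) (hB : EllipticPowerAlgebraicTwistedCarriers) :
    AndreSplitWeilClasses := by
  obtain ⟨E₀, hE₀, -⟩ := exists_abelianVariety_dim_one_cupProduct_ne_zero
  exact andreSplitWeilClasses_of_ellipticTensorWeilTwistedCarriers hC hDoor h hE₀ fun C n p h2 h4 ↦
    weilTensorCarrierAt_of_ellipticPowerAlgebraicCarrierAt hE₀ (hB C n p h2 h4)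

/-- `AndreSplitWeilClasses ⟸ K-C ∧ TwistedPerfectDoor ∧ tensor fact ∧ AbelianTwistedDesigns` (pinned twisted designs on all polarised abelian varieties,
`2 ≤ p ≤ n − 2`, through AB-d's `ellipticPowerAlgebraicCarrierAt_of_pinnedDesignAt`). [cite: Bloch1972Semiregularity, Remark (7.5)] -/
theorem andreSplitWeilClasses_of_abelianTwistedDesigns (hC : VHCAbelianSchemesRoad.ChernCharacterOnBetti)
    (hDoor : VHCAbelianSchemesRoad.TwistedPerfectDoor) (h : andre1996_splitWeilClasses_weilTensorPencil) (hB : AbelianTwistedDesigns) :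
    AndreSplitWeilClasses :=
  andreSplitWeilClasses_of_ellipticPowerAlgebraicTwistedCarriers hC hDoor h fun C n p h2 h4 ↦
    ellipticPowerAlgebraicCarrierAt_of_pinnedDesignAt (hB C n p h2 h4)

/-! ## §4 (appended) Placement: `AndreSplitWeilClasses` is a case of the ladder's R3⁺ ∧ R∞ -/

section Placement

open Polynomial
open Summit.HodgeConjecture.HodgeConjecture.Ring2.Hypotheses (WeilClassesWeilTypeCM)
open Summit.HodgeConjecture.HodgeConjecture.WeilTypeLadder (WeilClassesImaginaryQuadratic)

/-- A Weil-type CM datum with `e₀ = 1` has `R = T + d` for a positive integer `d` (`R` is monic of degree one and its root is real negative).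
[cite: Deligne1982HodgeCycles, §4 p. 30] -/
theorem exists_eq_X_add_C_of_isWeilTypeCM_one {B : AbelianVariety ℂ} {η : B ⟶ B} {R : Polynomial ℤ} {p : ℕ} (hB : IsWeilTypeCM B η R 1 p) :
    ∃ d : ℕ, 0 < d ∧ R = X + C (d : ℤ) := by
  set c : ℤ := R.coeff 0 with hc
  have hR : R = X + C c := hB.monic.eq_X_add_C hB.natDegree_eq
  have hroot := hB.root_real_neg (-(c : ℂ)) (by
    rw [hR, eval₂_add, eval₂_X, eval₂_C, eq_intCast, neg_add_cancel])
  have hpos : 0 < c := by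
    have h2 := hroot.2
    rw [Complex.neg_re, Complex.intCast_re, neg_lt_zero] at h2
    exact_mod_cast h2
  refine ⟨c.toNat, by omega, ?_⟩
  rw [Int.toNat_of_nonneg hpos.le]
  exact hR

/-- **`AndreSplitWeilClasses ⟸ WeilClassesWeilTypeCM ∧ WeilClassesImaginaryQuadratic`**: the new class target is a CASE of the ladder's rung R3 on Deligne's carriers (`e₀ ≥ 2`) and
of Weil's question R∞ (`e₀ = 1`, `p ≥ 2`, where `R = T + d`, `η ≫ η = -d` and `W_E ⊗ ℂ = weilClassesOf B η p d`; `p = 1` is Lefschetz) — it forgets the split polarisation, so it is no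
stronger than the ladder's existing open targets. [cite: Deligne1982HodgeCycles, §4 (4.4), Prop. 4.4] [cite: vanGeemen1994HodgeAV, 4.9] [cite: MoonenZarhin1998WeilClasses, §1] -/
theorem andreSplitWeilClasses_of_weilClassesWeilTypeCM_of_weilClassesImaginaryQuadratic (hR3 : WeilClassesWeilTypeCM)
    (hRinf : WeilClassesImaginaryQuadratic) : AndreSplitWeilClasses := by
  intro B η R e₀ p e a hB _ _ _ _ w hw hwQ
  have hpp := hB.isOfHodgeType_of_mem_weilClassesField MoonenZarhin1998_weilClasses_hodgeCriterion_holds hw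
  by_cases he : 2 ≤ e₀
  · exact hR3 B η R e₀ p he hB w hw hwQ hpp
  obtain rfl : e₀ = 1 := by have := hB.e₀_pos; omega
  obtain _ | _ | p := p
  · exact absurd hB.k_pos (lt_irrefl 0)
  · exact lefschetzOneOne_rational_holds hB.isSmoothProjective w hwQ hpp
  · obtain ⟨d, hd, rfl⟩ := exists_eq_X_add_C_of_isWeilTypeCM_one hB
    have hW := hB.isWeilType_quadratic
    have hdim : B.dim = 2 * (p + 2) := by rw [hB.dim_eq, mul_one]
    rw [weilClassesField_X_add_C_comp_eq_weilClassesOf] at hw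
    rw [hdim] at hpp
    exact hRinf (p + 2) (by omega) d hd B η hdim (hdim ▸ hB.isSmoothProjective) hW.sq_eq w hwQ hpp hw

end Placement

end Summit.HodgeConjecture.HodgeConjecture.Ring2.AbelianAll

end
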